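import Literature.NumberTheory.EllipticCurves.SwanConductorTorsionDichotomyProofs
import Literature.NumberTheory.EllipticCurves.OpenImageMazurProofs
import Literature.NumberTheory.EllipticCurves.OpenImageMazurCharacterProofs
import Literature.NumberTheory.GaloisRepresentations.ArtinConductorHasseArfDischargeProofs
import HarnessLib

/-!
# A stable line in `E[ℓ]` makes the Swan conductor of `E[ℓ]` even; an odd Swan conductor makes
# `E[ℓ]` irreducible (Diamond–Kramer 1995, Lemma 3; Ribet 1997, Prop. 1, additive case)

`Proofs` file (theorems only: no definitions, no named facts), topic `NumberTheory/EllipticCurves`.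
Source: K. Ribet, *On the equation `aᵖ + 2^α bᵖ + cᵖ = 0`*, Acta Arith. 79 (1997), proof of
Prop. 1, p. 12 — "Now suppose that `E` is not semistable; this means that `E` has additive
reduction at `2`.  Then the indicated irreducibility follows from a stronger statement which is
proved by Diamond and Kramer in [8]: Let `I` be an inertia subgroup of `Gal(ℚ̄/ℚ)` for the prime
`2`; then the action of `I` on `E[l]` is irreducible if `l ≥ 3`. … the `2`-part of `N_E` may be
written `2^{2+δ}`, where `δ` is the exponent of the Swan conductor of the representation given by
the action of `I` on `E[l]`. … Assume now that `E[l]` is reducible as an `I`-module.  Then `E[l]`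
is an extension of one `1`-dimensional representation by another, and `δ` is the sum of the
conductors of the two characters associated with the `1`-dimensional representations.  These
characters are in fact inverses of each other, since `I` acts trivially on the determinant of
`E[l]`. … Hence the conductors of the two characters are equal, giving that `δ` is even."
(F. Diamond, K. Kramer, *Modularity of a family of elliptic curves*, Math. Res. Lett. 2 (1995),
Lemma 3.)

## What is proved (over any number field `K`, any prime `ℓ`, any prime `𝔓 ∣ v ∤ ℓ` of `\bar ℤ_K`)

* `exists_galoisRep_character` — the rank-one continuous representation `χ(σ) x = r(σ) x` of a
  character `r : Γ_K → Aˣ` with open kernel over a discrete field `A`;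
  `codimFixed_eq_ite_of_character` — `codim A^G ∈ {0, 1}` according as `r(G) = 1` or not.
* `exists_smul_geomTorsion_ne_iff_of_isogenyCharacter` — a wild group `Γ_K^u(𝔓)` moves `E[ℓ]`
  iff the isogeny character of a stable line is non-trivial on it (`det = χ̄_ℓ` is tame, the wild
  groups act through `p`-groups, `p ≠ ℓ`).
* `exists_swanConductorAt_torsion_eq_two_mul_of_stable_line` — **Diamond–Kramer, Lemma 3**: a
  `Γ_K`-stable line `H ⊂ E[ℓ]` forces `Sw_𝔓(E[ℓ]) = 2 · Sw_𝔓(χ) ∈ 2ℕ`, the integrality of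
  `Sw_𝔓(χ) = a_𝔓(χ) − codim χ^{I_𝔓}` being the tree's Artin–Katz integrality theorem
  `GaloisRep.exists_natCast_eq_artinConductorAt_of_hasOpenInertiaKerAt_holds` (Katz 1988,
  Prop. 1.9, from Hasse–Arf, `hasseArf_holds`) — "`δ` is the sum of the conductors of the two
  characters", conductors of characters being integers.
* `exists_swanConductorAt_torsion_eq_two_mul_of_not_hasIrreducibleModPGaloisRep` — the same
  from `¬ HasIrreducibleModPGaloisRep` (a stable subgroup `≠ ⊥, ⊤` is a line).
* `hasIrreducibleModPGaloisRep_of_swanConductorAt_torsion_eq_one` — **Ribet 1997, Prop. 1,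
  additive case, in the form used for Theorem 3**: if `Sw_𝔓(E[ℓ]) = 1` at some `𝔓 ∣ v ∤ ℓ`, then
  `E[ℓ]` is an irreducible `Γ_K`-module (indeed it has no `Γ_K`-stable line at all).

The architecture (and most proofs) follow the summit-side theorem
`Summit.ABC.ABC.Theorems.stub_swanEvenOfStableLine` (the case `K = ℚ`, `ℓ = 5`), rewritten for a
general number field and prime and placed in `Literature/` so that literature facts may use it.
No definitions, no named facts (D-0026).  All axioms `propext`, `Classical.choice`, `Quot.sound`.

## References

* [Ribet1997] K. A. Ribet, Acta Arith. 79 (1997), Prop. 1 and its proof (p. 11–12).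
* [DiamondKramer1995] F. Diamond, K. Kramer, Math. Res. Lett. 2 (1995), 299–304, Lemma 3.
* [Katz1988] N. M. Katz, *Gauss Sums, Kloosterman Sums, and Monodromy Groups* (1988), Ch. 1,
  1.1, Prop. 1.9.
* [SerreLocalFields1979] J.-P. Serre, *Local Fields*, GTM 67 (1979), Ch. IV §3, Ch. VI §2.
* [Mazur1978] B. Mazur, *Rational isogenies of prime degree*, Invent. Math. 44 (1978), §5
  (the isogeny character).
-/

noncomputable section

open scoped NumberField Classical

open MeasureTheory Field IsDedekindDomain

namespace Literature.NumberTheory.EllipticCurves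

open Literature.NumberTheory.GaloisRepresentations
-- `_root_`: the import closure declares `Literature.NumberTheory.EllipticCurves.WeierstrassCurve.*`
open _root_.WeierstrassCurve

universe u

/-! ## The rank-one Galois representation of a character with open kernel -/

section Character

variable {K : Type*} [Field K] {A : Type*} [Field A] [TopologicalSpace A] [DiscreteTopology A]

/-- **The rank-one Galois representation of a character with open kernel.**  For a field `K`, a
discrete field `A` and a homomorphism `r : Γ_K → Aˣ` with open kernel, there is a continuous
`A`-linear representation `χ` of `Γ_K` on `A` (`GaloisRep K A A`) with `χ(σ) x = r(σ) x`:
`σ ↦ r(σ)` is continuous (a homomorphism with open kernel is locally constant), hence so is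
`(σ, x) ↦ r(σ) x`.  (Katz 1988, Ch. 1, 1.1: a representation with open kernel is continuous for
the discrete topology.) [cite: Katz1988, Ch. 1, 1.1] -/
theorem exists_galoisRep_character (r : absoluteGaloisGroup K →* Aˣ)
    (hr : IsOpen ((r.ker : Subgroup (absoluteGaloisGroup K)) : Set (absoluteGaloisGroup K))) :
    ∃ χ : GaloisRep K A A, ∀ (σ : absoluteGaloisGroup K) (x : A), χ σ x = (r σ : A) * x := by
  -- `σ ↦ (r σ : A)` is continuous: it is a homomorphism with open kernel
  set f : absoluteGaloisGroup K →* A := (Units.coeHom A).comp r with hf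
  have hcont : Continuous f := by
    refine continuous_of_continuousAt_one f ?_
    rw [ContinuousAt, map_one]
    refine Filter.tendsto_def.mpr fun U hU ↦ Filter.mem_of_superset (hr.mem_nhds r.ker.one_mem) ?_
    intro x hx
    rw [Set.mem_preimage, hf, MonoidHom.comp_apply, (MonoidHom.mem_ker).mp hx, map_one]
    exact mem_of_mem_nhds hU
  -- the representation `σ ↦ (x ↦ r(σ) x)`
  let ρ : Representation A (absoluteGaloisGroup K) A :=
    (algebraMap A (Module.End A A) : A →* Module.End A A).comp f
  refine ⟨⟨ρ, ?_⟩, fun σ x ↦ ?_⟩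
  · change Continuous fun p : absoluteGaloisGroup K × A ↦ ρ p.1 p.2
    have : (fun p : absoluteGaloisGroup K × A ↦ ρ p.1 p.2) = fun p ↦ f p.1 * p.2 := by
      funext p
      simp [ρ, Module.algebraMap_end_apply]
    rw [this]
    exact (hcont.comp continuous_fst).mul continuous_snd
  · change ρ σ x = _
    simp [ρ, hf, Module.algebraMap_end_apply]

omit [DiscreteTopology A] in
/-- **`codim_A A^{G} = 0` if the character is trivial on `G`, `= 1` otherwise.**  For the rank-one
representation `χ(σ) x = r(σ) x` of `Γ_K` on the field `A` and a subgroup `G ≤ Γ_K`: if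
`r(G) = 1` then `G` acts trivially (`codimFixed_eq_zero_of_forall_eq_one`); if `r(σ) ≠ 1` for some
`σ ∈ G` then a fixed vector `x` has `(r(σ) - 1) x = 0`, so `x = 0`, the fixed space is `0` and its
codimension is `dim_A A = 1`.  (Serre, *Local Fields*, VI §2: for a character, `codim V^{G_i}` is
`0` or `1` according as `G_i ≤ ker` or not.) [cite: SerreLocalFields1979, Ch. VI §2] -/
theorem codimFixed_eq_ite_of_character {r : absoluteGaloisGroup K →* Aˣ} {χ : GaloisRep K A A}
    (hχ : ∀ (σ : absoluteGaloisGroup K) (x : A), χ σ x = (r σ : A) * x)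
    (G : Subgroup (absoluteGaloisGroup K)) :
    χ.codimFixed G = if ∀ σ ∈ G, r σ = 1 then 0 else 1 := by
  split_ifs with h
  · exact ContinuousRep.codimFixed_eq_zero_of_forall_eq_one χ fun σ hσ ↦
      LinearMap.ext fun x ↦ by rw [hχ, h σ hσ, Units.val_one, one_mul, Module.End.one_apply]
  · push Not at h
    obtain ⟨σ, hσ, hrσ⟩ := h
    have hbot : χ.fixedSubmodule G = ⊥ := by
      rw [Submodule.eq_bot_iff]
      intro x hx
      have hfix : χ σ x = x := (ContinuousRep.mem_fixedSubmodule_iff χ G x).mp hx σ hσ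
      rw [hχ] at hfix
      have h0 : ((r σ : A) - 1) * x = 0 := by rw [sub_mul, one_mul, hfix, sub_self]
      rcases mul_eq_zero.mp h0 with h1 | h1
      · exact absurd (Units.val_eq_one.mp (sub_eq_zero.mp h1)) hrσ
      · exact h1
    rw [ContinuousRep.codimFixed_eq_finrank_sub, hbot, finrank_bot, Module.finrank_self]

end Character

/-! ## The wild groups move `E[ℓ]` iff the isogeny character is non-trivial on them -/

section Claim

variable {K : Type u} [Field K] [NumberField K] (W : WeierstrassCurve K) (ℓ : ℕ) [Fact ℓ.Prime]

/-- **A wild ramification group moves `E[ℓ]` iff the isogeny character of a stable line is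
non-trivial on it.**  For an elliptic curve `E/K` over a number field, a prime `ℓ`, a prime
`𝔓 ∣ v ∤ ℓ` of `\bar ℤ_K`, `u > 0`, and a point `P ≠ O` of `E[ℓ]` spanning a `Γ_K`-stable line with
isogeny character `r` (`σ P = r(σ) P`): `Γ_K^u(𝔓)` moves some point of `E[ℓ]` iff `r(σ) ≠ 1` for
some `σ ∈ Γ_K^u(𝔓)`.  (⇐) such a `σ` moves `P` (`P` has order `ℓ`,
`Mazur1978.eq_one_of_val_smul_eq`); (⇒) if `r(Γ^u) = 1` then `Γ^u` fixes `P ≠ O`, hence fixes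
`E[ℓ]` pointwise, because `Γ^u ≤ I_𝔓` fixes `μ_ℓ` and acts through a `p`-group, `p ≠ ℓ` — an
element with a non-zero fixed vector and trivial determinant `χ̄_ℓ` is unipotent of `p`-power
order, so trivial (the tree's
`forall_smul_geomTorsion_eq_of_smul_eq_of_ne_zero_of_mem_absUpperRamificationSubgroup`).  This
is the sentence "these characters are in fact inverses of each other, since `I` acts trivially on
the determinant of `E[l]`" of Ribet's rendering of Diamond–Kramer's Lemma 3.
[cite: Ribet1997, proof of Prop. 1 (p. 12)] [cite: DiamondKramer1995, Lemma 3] -/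
theorem exists_smul_geomTorsion_ne_iff_of_isogenyCharacter [W.IsElliptic]
    {v : HeightOneSpectrum (𝓞 K)} (hℓ : (ℓ : 𝓞 K) ∉ v.asIdeal)
    {𝔓 : Ideal (absIntegers (𝓞 K) K)} (h𝔓 : 𝔓 ∈ v.primesAbove) {u : ℝ} (hu : 0 < u)
    {P : geomTorsion W ℓ} (hP0 : P ≠ 0) {r : absoluteGaloisGroup K →* (ZMod ℓ)ˣ}
    (hr : ∀ σ : absoluteGaloisGroup K, σ • P = ((r σ : (ZMod ℓ)ˣ) : ZMod ℓ).val • P) :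
    (∃ σ ∈ absUpperRamificationSubgroup (𝓞 K) 𝔓 u, ∃ T : geomTorsion W ℓ, σ • T ≠ T) ↔
      ¬ ∀ σ ∈ absUpperRamificationSubgroup (𝓞 K) 𝔓 u, r σ = 1 := by
  haveI : Fact (1 < ℓ) := ⟨(Fact.out : ℓ.Prime).one_lt⟩
  constructor
  · rintro ⟨σ, hσ, T, hT⟩ hall
    refine hT (W.forall_smul_geomTorsion_eq_of_smul_eq_of_ne_zero_of_mem_absUpperRamificationSubgroup
      ℓ hℓ h𝔓 hu hP0 (fun τ hτ ↦ ?_) σ hσ T)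
    rw [hr τ, hall τ hτ, Units.val_one, ZMod.val_one, one_smul]
  · intro h
    push Not at h
    obtain ⟨σ, hσ, hrσ⟩ := h
    refine ⟨σ, hσ, P, fun hfix ↦ hrσ (Units.ext ?_)⟩
    rw [hr σ] at hfix
    rw [Units.val_one]
    exact Mazur1978.eq_one_of_val_smul_eq W ℓ hP0 hfix

end Claim

/-! ## Diamond–Kramer's Lemma 3: the Swan conductor is even along a stable line -/

section Parity

variable {K : Type u} [Field K] [NumberField K] (W : WeierstrassCurve K) (ℓ : ℕ) [Fact ℓ.Prime]

attribute [local instance] AddSubgroup.torsionBy.zmodModule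

/-- The residue cardinality `q_v` is non-zero in `𝔽_ℓ` when `v ∤ ℓ` (`q_v` is a power of the
residue characteristic `p ∈ v`, and `p ≠ ℓ`). [folklore] -/
theorem natCast_residueCard_ne_zero_of_not_mem {v : HeightOneSpectrum (𝓞 K)}
    (hℓ : (ℓ : 𝓞 K) ∉ v.asIdeal) : (v.residueCard : ZMod ℓ) ≠ 0 := by
  obtain ⟨p, hp, hpv, m, hm⟩ := GaloisRep.exists_prime_mem_residueCard_eq (K := K) v
  have hpℓ : p ≠ ℓ := by
    rintro rfl
    exact hℓ hpv
  have hp0 : (p : ZMod ℓ) ≠ 0 := by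
    rw [Ne, ZMod.natCast_eq_zero_iff]
    exact fun hdvd ↦ hpℓ ((Nat.prime_dvd_prime_iff_eq Fact.out hp).mp hdvd).symm
  rw [hm, Nat.cast_pow]
  exact pow_ne_zero _ hp0

/-- **Diamond–Kramer 1995, Lemma 3 / Ribet 1997, proof of Prop. 1: along a stable line the Swan
conductor of `E[ℓ]` is even.**  For an elliptic curve `E/K` over a number field, a prime `ℓ`, a
point `P ≠ O` of `E[ℓ]` spanning a `Γ_K`-stable line, a place `v ∤ ℓ` and a prime `𝔓 ∣ v` of
`\bar ℤ_K`: `Sw_𝔓(E[ℓ]) = 2n` for some `n ∈ ℕ`.  Proof: with the isogeny character `r` of the line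
(`Mazur1978.exists_isogenyCharacter`, open kernel `Mazur1978.isOpen_ker_of_smul_eq`), for `u > 0`
`codim E[ℓ]^{Γ^u} = 2 · [Γ^u moves E[ℓ]]`
(`codimFixed_torsionGaloisRep_absUpperRamificationSubgroup_eq_ite`) `= 2 · [r(Γ^u) ≠ 1]`
(`exists_smul_geomTorsion_ne_iff_of_isogenyCharacter`) `= 2 · codim χ^{Γ^u}` for the rank-one
representation `χ` of `r` over `𝔽_ℓ` (`exists_galoisRep_character`, `codimFixed_eq_ite_of_character`),
so `Sw_𝔓(E[ℓ]) = 2 Sw_𝔓(χ)`; and `Sw_𝔓(χ) = a_𝔓(χ) - codim χ^{I_𝔓} ∈ ℕ` because `a_𝔓(χ) ∈ ℕ`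
(`GaloisRep.exists_natCast_eq_artinConductorAt_of_hasOpenInertiaKerAt_holds`: coefficients `𝔽_ℓ`
with `q_v ≠ 0` in `𝔽_ℓ`, inertia acting through the finite discrete quotient `Γ_K / ker r`; Katz
1.9 from Hasse–Arf) and `Sw_𝔓(χ) ≥ 0` (`swanConductorAt_nonneg`).
[cite: Ribet1997, proof of Prop. 1 (p. 12)] [cite: DiamondKramer1995, Lemma 3]
[cite: Katz1988, Ch. 1, Prop. 1.9] -/
theorem exists_swanConductorAt_torsion_eq_two_mul_of_stable_line [W.IsElliptic]
    {v : HeightOneSpectrum (𝓞 K)} (hℓ : (ℓ : 𝓞 K) ∉ v.asIdeal)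
    {𝔓 : Ideal (absIntegers (𝓞 K) K)} (h𝔓 : 𝔓 ∈ v.primesAbove)
    {P : geomTorsion W ℓ} (hP0 : P ≠ 0)
    (hst : ∀ σ : absoluteGaloisGroup K, σ • P ∈ AddSubgroup.zmultiples P) :
    ∃ n : ℕ, (W.torsionGaloisRep ℓ).swanConductorAt (𝓞 K) 𝔓 = 2 * n := by
  -- the isogeny character `r` of the stable line `𝔽_ℓ P`
  obtain ⟨r, hr⟩ := Mazur1978.exists_isogenyCharacter W ℓ hP0 hst
  have hker : IsOpen ((r.ker : Subgroup (absoluteGaloisGroup K)) : Set (absoluteGaloisGroup K)) :=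
    Mazur1978.isOpen_ker_of_smul_eq W ℓ hP0 hr
  -- the rank-one Galois representation `χ` of `r` over `𝔽_ℓ`
  obtain ⟨χ, hχ⟩ := exists_galoisRep_character (K := K) (A := ZMod ℓ) r hker
  -- `Sw_𝔓(E[ℓ]) = 2 · Sw_𝔓(χ)`: the integrands agree on `u > 0`
  have hSw : (W.torsionGaloisRep ℓ).swanConductorAt (𝓞 K) 𝔓 =
      2 * χ.swanConductorAt (𝓞 K) 𝔓 := by
    rw [GaloisRep.swanConductorAt_def, GaloisRep.swanConductorAt_def, ← integral_const_mul]
    refine setIntegral_congr_fun measurableSet_Ioi fun u hu ↦ ?_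
    rw [Set.mem_Ioi] at hu
    rw [W.codimFixed_torsionGaloisRep_absUpperRamificationSubgroup_eq_ite ℓ hℓ h𝔓 hu,
      exists_smul_geomTorsion_ne_iff_of_isogenyCharacter W ℓ hℓ h𝔓 hu hP0 hr,
      codimFixed_eq_ite_of_character hχ]
    split_ifs <;> norm_num
  -- `a_𝔓(χ) ∈ ℕ` (Artin–Katz integrality over `𝔽_ℓ`, `q_v ≠ 0` in `𝔽_ℓ`), hence `Sw_𝔓(χ) ∈ ℕ`
  have hchar : (v.residueCard : ZMod ℓ) ≠ 0 := natCast_residueCard_ne_zero_of_not_mem ℓ hℓ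
  have hopen : χ.HasOpenInertiaKerAt (𝓞 K) 𝔓 :=
    ⟨r.ker, hker, fun σ hσ _ ↦ LinearMap.ext fun x ↦ by
      rw [hχ, (MonoidHom.mem_ker).mp hσ, Units.val_one, one_mul, Module.End.one_apply]⟩
  obtain ⟨n, hn⟩ :=
    GaloisRep.exists_natCast_eq_artinConductorAt_of_hasOpenInertiaKerAt_holds h𝔓 χ hchar hopen
  rw [GaloisRep.artinConductorAt_def] at hn
  set m := χ.codimFixed (𝔓.inertia (absoluteGaloisGroup K)) with hm
  have hnonneg := χ.swanConductorAt_nonneg (R := 𝓞 K) 𝔓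
  have hmn : (m : ℝ) ≤ n := by linarith
  have hmn' : m ≤ n := by exact_mod_cast hmn
  refine ⟨n - m, ?_⟩
  rw [hSw, Nat.cast_sub hmn']
  linarith

/-- **Reducible `E[ℓ]` has even Swan conductor at every `𝔓 ∤ ℓ`** (Diamond–Kramer 1995, Lemma 3,
read through the tree's dictionary "reducible ⟺ a stable subgroup of order `ℓ`",
`Mazur1978.not_hasIrreducibleModPGaloisRep_iff_exists_natCard_eq`): if the `Γ_K`-module `E[ℓ]`
is not irreducible, then `Sw_𝔓(E[ℓ]) ∈ 2ℕ` for every prime `𝔓 ∣ v ∤ ℓ` of `\bar ℤ_K`.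
[cite: Ribet1997, proof of Prop. 1 (p. 12)] [cite: DiamondKramer1995, Lemma 3] -/
theorem exists_swanConductorAt_torsion_eq_two_mul_of_not_hasIrreducibleModPGaloisRep
    [W.IsElliptic] {v : HeightOneSpectrum (𝓞 K)} (hℓ : (ℓ : 𝓞 K) ∉ v.asIdeal)
    {𝔓 : Ideal (absIntegers (𝓞 K) K)} (h𝔓 : 𝔓 ∈ v.primesAbove)
    (hred : ¬ W.HasIrreducibleModPGaloisRep ℓ) :
    ∃ n : ℕ, (W.torsionGaloisRep ℓ).swanConductorAt (𝓞 K) 𝔓 = 2 * n := by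
  haveI : NeZero (ℓ : K) := ⟨Nat.cast_ne_zero.mpr (Fact.out : ℓ.Prime).ne_zero⟩
  obtain ⟨H, hHst, hHcard⟩ :=
    (Mazur1978.not_hasIrreducibleModPGaloisRep_iff_exists_natCard_eq W ℓ).mp hred
  obtain ⟨P, hP0, hHP⟩ := Mazur1978.exists_eq_zmultiples_of_natCard_eq W ℓ hHcard
  have hPH : P ∈ H := by
    rw [hHP]
    exact AddSubgroup.mem_zmultiples P
  have hst : ∀ σ : absoluteGaloisGroup K, σ • P ∈ AddSubgroup.zmultiples P := fun σ ↦ by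
    rw [← hHP]
    exact hHst σ P hPH
  exact exists_swanConductorAt_torsion_eq_two_mul_of_stable_line W ℓ hℓ h𝔓 hP0 hst

/-- **Ribet 1997, Prop. 1 (additive case) in the form used for Theorem 3: an odd Swan conductor
forces irreducibility.**  If `Sw_𝔓(E[ℓ]) = 1` at some prime `𝔓 ∣ v ∤ ℓ` of `\bar ℤ_K` (for the
Frey curves `y² = x(x − A)(x + B)` with `ord₂ B ∈ {2, 3}` this is `δ = 1`, Ribet p. 12: "`2 + δ` is
equal to either `5` or `3`; thus `δ` is an odd number"), then `E[ℓ]` is an irreducible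
`Γ_K`-module. [cite: Ribet1997, Prop. 1 and its proof (p. 11–12)] [cite: DiamondKramer1995, Lemma 3] -/
theorem hasIrreducibleModPGaloisRep_of_swanConductorAt_torsion_eq_one [W.IsElliptic]
    {v : HeightOneSpectrum (𝓞 K)} (hℓ : (ℓ : 𝓞 K) ∉ v.asIdeal)
    {𝔓 : Ideal (absIntegers (𝓞 K) K)} (h𝔓 : 𝔓 ∈ v.primesAbove)
    (hSw : (W.torsionGaloisRep ℓ).swanConductorAt (𝓞 K) 𝔓 = 1) :
    W.HasIrreducibleModPGaloisRep ℓ := by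
  by_contra hred
  obtain ⟨n, hn⟩ :=
    exists_swanConductorAt_torsion_eq_two_mul_of_not_hasIrreducibleModPGaloisRep W ℓ hℓ h𝔓 hred
  rw [hSw] at hn
  have h : (1 : ℝ) = 2 * (n : ℝ) := hn
  have h' : (1 : ℕ) = 2 * n := by exact_mod_cast h
  omega

end Parity

end Literature.NumberTheory.EllipticCurves
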